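import Mathlib
import HarnessLib
import Summits.HubbardSuperconductivity.HubbardSuperconductivity.Theorems.KLProgrammeKLRegimeTwoCutoffScaleZeroStep
import Summits.HubbardSuperconductivity.HubbardSuperconductivity.Theorems.KLProgrammeKLRegimeSplitTwoLegMomentsFromGrid
import Summits.HubbardSuperconductivity.HubbardSuperconductivity.Theorems.KLProgrammeKLRegimeSplitBundleV16
import Literature.MathematicalPhysics.QuantumLattice.HubbardMatsubaraCutoffEffAction

/-!
# Route `KLProgramme` — ENGINE child `KLRegimeEngineV16` (stmt-HubbardSuperconductivity-20236), `stub_twoLeg_scale0`, conjunct (E3f-AT)₀,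
# the CUTOFF leg: the two-cutoff difference of the scale-0 LOCAL PART `klLocalPart … 0` read out of ONE grid (cell gate-hubbard-kl,
# seat hubbard-kl-k3c4-p2 g6; technique «Matsubara all-U route», route (C))

Sequel of `…TwoCutoffScaleZeroStep` (the pinned kernel difference of the two scale-`Λ₀` grid effective actions `G″_g, G_g` on the `4M″` grid, every
degree) composed with p1b's M-uniform grid read-out `TwoLegFourier.sum_evenWeight_abs_torusCosCoeff_locRe_map_gridSub_le`:

* `klEffectiveAction_zero_eq_map_gridSub` — for EVERY grid `N ≥ 4M` (not only `4M`): `𝒱⁽⁰⁾_{L,M} = map S_N (effAction (S_Nᵀ C^{K,M}_{>e₀} S_N) W_N)`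
  (`map_hubbardGridSub_gridInteraction/…CounterQuadratic` + `effAction_map`);
* `klSelfEnergy_zero_twoCutoff_eq` — at the two lowest frequencies the cutoff-`M″` self-energy IS the cutoff-`M` reading of the grid element `G″_g`:
  `klSelfEnergy L M″ … 0 (±ω₀″, k) σ = selfEnergy L M β (map S G″_g) (±ω₀, k) σ` (`selfEnergy_cutoffRestrict_omega0` ∘ `cutoffRestrict_map_gridSub`);
* **`abs_klLocalPart_zero_twoCutoff_sub_le_of_grid`** — hence for any grid elements with those momentum images and any pinned two-leg bound `B` of
  their difference, `|klLocalPart L M … 0 θ − klLocalPart L M″ … 0 θ| ≤ (2N/|β|)·B` at EVERY angle `θ` (`N = 4M″`);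
* **`abs_klLocalPart_zero_twoCutoff_sub_le`** — with `B` from `sum_norm_kernel_twoCutoff_effAction_sub_le` (degree `2`, pin at leg `0`):
  `≤ (2N/|β|)·ρ_C^{-2}·e‖D‖_h/(1−θ_C)²` — the profiles carry the grid weight `β/N`, so the product is `O(β/√M)` (sequel: chaining + thresholds).

Proof only; no definitions; nothing about the model's physics is asserted beyond the stated inequalities.
-/

noncomputable section

namespace Summit.HubbardSuperconductivity.HubbardSuperconductivity.Theorems.TwoVolumeDefect

set_option linter.dupNamespace false -- summit = problem name (single-conjunct summit), D-0017

open Finset Complex Literature.MathematicalPhysics.QuantumLattice Literature.Probability.LatticeModels GrassmannAlgebra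
open Summit.HubbardSuperconductivity.HubbardSuperconductivity.Theorems.KLRegimeSplit
open Summit.HubbardSuperconductivity.HubbardSuperconductivity.Theorems.KLProgrammeLegKernels
open Summit.HubbardSuperconductivity.HubbardSuperconductivity.Theorems.TwoLegFourier

variable {L M M'' : ℕ} [NeZero L]

/-! ## §1 The scale-0 effective action is the momentum image of the grid effective action, on every grid `N ≥ 4M` -/

/-- **`𝒱⁽⁰⁾_{L,M} = map S_N G_g` on every grid with `4M ≤ N + 1`, `2M ≤ N`** (the engine's `klEffectiveAction_zero_eq_effAction_map` is the case
`N = 4M`; here the cutoff-`M` theory is read on the finer grid of a larger cutoff). -/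
theorem klEffectiveAction_zero_eq_map_gridSub [NeZero M] {N : ℕ} [NeZero N] {β : ℝ} (hβ : β ≠ 0) (U μ : ℝ) (K : TrigPolyC4v)
    (hN : 4 * M ≤ N + 1) (hN2 : 2 * M ≤ N) :
    klEffectiveAction L M β U μ K klE0 0 =
      ExteriorAlgebra.map (Matrix.toLin' (hubbardGridSub L M β N))
        (effAction ℂ ((hubbardGridSub L M β N).transpose * hubbardCovAboveCT L M β μ 0 K klE0 * hubbardGridSub L M β N)
          (hubbardGridInteraction L N β U + hubbardGridCounterQuadratic L N β K)) := by
  rw [klEffectiveAction, hubbardEffectiveActionCT, hubbardInteractionCT, ← map_hubbardGridSub_gridInteraction hβ U hN,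
    ← map_hubbardGridSub_gridCounterQuadratic hβ K hN2, ← map_add, effAction_map, LinearMap.toMatrix'_toLin']
  simp [klScale]

/-- **The scale-0 self-energy at `±ω₀` of the LARGER cutoff `M″` is the cutoff-`M` reading of the grid element `G″_g`** (`M ≤ M″`, grid `N = 4M″`):
`klSelfEnergy L M″ … 0 (ω₀″, k) σ = selfEnergy L M β (map S_N G″_g) (ω₀, k) σ` and the same at `−ω₀`. -/
theorem klSelfEnergy_zero_twoCutoff_eq [NeZero M] [NeZero M''] (h : M ≤ M'') {β : ℝ} (hβ : β ≠ 0) (U μ : ℝ) (K : TrigPolyC4v)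
    (k : TorusSite 2 L) (σ : Fin 2) :
    klSelfEnergy L M'' β U μ K klE0 0 (omega0 M'', k) σ =
        selfEnergy L M β (ExteriorAlgebra.map (Matrix.toLin' (hubbardGridSub L M β (2 * (2 * M''))))
          (effAction ℂ ((hubbardGridSub L M'' β (2 * (2 * M''))).transpose * hubbardCovAboveCT L M'' β μ 0 K klE0 *
              hubbardGridSub L M'' β (2 * (2 * M'')))
            (hubbardGridInteraction L (2 * (2 * M'')) β U + hubbardGridCounterQuadratic L (2 * (2 * M'')) β K))) (omega0 M, k) σ ∧
      klSelfEnergy L M'' β U μ K klE0 0 ((omega0 M'').rev, k) σ =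
        selfEnergy L M β (ExteriorAlgebra.map (Matrix.toLin' (hubbardGridSub L M β (2 * (2 * M''))))
          (effAction ℂ ((hubbardGridSub L M'' β (2 * (2 * M''))).transpose * hubbardCovAboveCT L M'' β μ 0 K klE0 *
              hubbardGridSub L M'' β (2 * (2 * M'')))
            (hubbardGridInteraction L (2 * (2 * M'')) β U + hubbardGridCounterQuadratic L (2 * (2 * M'')) β K))) ((omega0 M).rev, k) σ := by
  haveI : NeZero (2 * (2 * M'')) := ⟨by have := NeZero.ne M''; omega⟩
  have hid := klEffectiveAction_zero_eq_map_gridSub (L := L) (M := M'') (N := 2 * (2 * M'')) hβ U μ K (by omega) (by omega)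
  have hres := selfEnergy_cutoffRestrict_omega0 (L := L) h β
    (ExteriorAlgebra.map (Matrix.toLin' (hubbardGridSub L M'' β (2 * (2 * M''))))
      (effAction ℂ ((hubbardGridSub L M'' β (2 * (2 * M''))).transpose * hubbardCovAboveCT L M'' β μ 0 K klE0 *
          hubbardGridSub L M'' β (2 * (2 * M'')))
        (hubbardGridInteraction L (2 * (2 * M'')) β U + hubbardGridCounterQuadratic L (2 * (2 * M'')) β K))) k σ
  simp only [hubbardGridSub, cutoffRestrict_map_gridSub] at hres
  simp only [klSelfEnergy, hid, hubbardGridSub]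
  exact ⟨hres.1.symm, hres.2.symm⟩

/-! ## §2 The two-cutoff difference of the local part from a pinned two-leg bound of the grid difference -/

/-- The pinned two-leg sum over the partner point is a sub-sum of the leg-`0`-pinned `ℓ¹` sum. -/
theorem sum_norm_kernel_two_string_le_pinned {P : Type*} [Fintype P] [DecidableEq P] (Δ : GrassmannAlgebra ℂ (GridLeg P)) (σ : Fin 2)
    (p₀ : P) :
    ∑ p₁ : P, ‖kernel ℂ Δ 2 (fun i => ((![p₀, p₁] i, σ), i))‖ ≤
      ∑ X ∈ univ.filter (fun X : Fin 2 → GridLeg P => X 0 = ((p₀, σ), 0)), ‖kernel ℂ Δ 2 X‖ := by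
  classical
  set ι : P → (Fin 2 → GridLeg P) := fun p₁ i => ((![p₀, p₁] i, σ), i) with hι
  have hinj : Function.Injective ι := by
    intro a b hab
    have := congrFun hab 1
    simp only [hι, Matrix.cons_val_one, Matrix.cons_val_fin_one, Prod.mk.injEq] at this
    exact this.1.1
  rw [← sum_image (f := fun X => ‖kernel ℂ Δ 2 X‖) fun a _ b _ hab => hinj hab]
  refine sum_le_sum_of_subset_of_nonneg (fun X hX => ?_) fun _ _ _ => norm_nonneg _
  obtain ⟨p₁, -, rfl⟩ := mem_image.1 hX
  exact mem_filter.2 ⟨mem_univ _, by simp [hι]⟩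

/-- **THE GRID READ-OUT OF THE TWO-CUTOFF DIFFERENCE OF THE SCALE-0 LOCAL PART.**  For `M ≤ M″` and grid elements `G_g, G″_g` on an `N`-grid
(`4M ≤ N + 1`, `2M ≤ N`) whose momentum images under the cutoff-`M` substitution `S = hubbardGridSub L M β N` carry the two scale-`0` self-energy data
(`𝒱⁽⁰⁾_{L,M} = map S G_g`, and the cutoff-`M″` self-energies at `±ω₀″` are the `±ω₀` self-energies of `map S G″_g` — `klEffectiveAction_zero_eq_map_gridSub`,
`klSelfEnergy_zero_twoCutoff_eq` on the `4M″` grid), if the leg-`0`-pinned two-leg kernels of `G″_g − G_g` are `≤ B` at every pin, then at every angle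
`|klLocalPart L M … 0 θ − klLocalPart L M″ … 0 θ| ≤ (2N/|β|)·B`. -/
theorem abs_klLocalPart_zero_twoCutoff_sub_le_of_grid [NeZero M] [NeZero M''] {N : ℕ} [NeZero N] {β : ℝ} (hβ : β ≠ 0) (U μ : ℝ)
    (K : TrigPolyC4v) (Gg G''g : GrassmannAlgebra ℂ (GridLeg (GridPoint L N)))
    (hG : klEffectiveAction L M β U μ K klE0 0 = ExteriorAlgebra.map (Matrix.toLin' (hubbardGridSub L M β N)) Gg)
    (hG'' : ∀ (k : TorusSite 2 L) (σ : Fin 2),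
      klSelfEnergy L M'' β U μ K klE0 0 (omega0 M'', k) σ =
          selfEnergy L M β (ExteriorAlgebra.map (Matrix.toLin' (hubbardGridSub L M β N)) G''g) (omega0 M, k) σ ∧
        klSelfEnergy L M'' β U μ K klE0 0 ((omega0 M'').rev, k) σ =
          selfEnergy L M β (ExteriorAlgebra.map (Matrix.toLin' (hubbardGridSub L M β N)) G''g) ((omega0 M).rev, k) σ)
    {B : ℝ}
    (hB : ∀ (σ : Fin 2) (w : GridLeg (GridPoint L N)),
      ∑ X ∈ univ.filter (fun X : Fin 2 → GridLeg (GridPoint L N) => X 0 = w), ‖kernel ℂ G''g 2 X - kernel ℂ Gg 2 X‖ ≤ B)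
    (θ : ℝ) :
    |klLocalPart L M β U μ K 0 θ - klLocalPart L M'' β U μ K 0 θ| ≤ 2 * (N : ℝ) / |β| * B := by
  -- the two local self-energy data are the localised data of `map S G_g` and `map S G″_g`
  have hdata : (fun k : TorusSite 2 L => klLocSelfEnergyRe L M β U μ K 0 k - klLocSelfEnergyRe L M'' β U μ K 0 k) =
      fun k => (∑ σ : Fin 2, ((selfEnergy L M β (ExteriorAlgebra.map (Matrix.toLin' (hubbardGridSub L M β N)) (Gg - G''g)) (omega0 M, k) σ).re +
        (selfEnergy L M β (ExteriorAlgebra.map (Matrix.toLin' (hubbardGridSub L M β N)) (Gg - G''g)) ((omega0 M).rev, k) σ).re)) / 4 := by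
    funext k
    have h1 : ∀ σ : Fin 2, klSelfEnergy L M'' β U μ K klE0 0 (omega0 M'', k) σ =
        selfEnergy L M β (ExteriorAlgebra.map (Matrix.toLin' (hubbardGridSub L M β N)) G''g) (omega0 M, k) σ := fun σ => (hG'' k σ).1
    have h2 : ∀ σ : Fin 2, klSelfEnergy L M'' β U μ K klE0 0 ((omega0 M'').rev, k) σ =
        selfEnergy L M β (ExteriorAlgebra.map (Matrix.toLin' (hubbardGridSub L M β N)) G''g) ((omega0 M).rev, k) σ := fun σ => (hG'' k σ).2
    have h3 : ∀ (n : MatsubaraIdx M) (σ : Fin 2), klSelfEnergy L M β U μ K klE0 0 (n, k) σ =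
        selfEnergy L M β (ExteriorAlgebra.map (Matrix.toLin' (hubbardGridSub L M β N)) Gg) (n, k) σ := fun n σ => by
      rw [klSelfEnergy, hG]
    simp only [klLocSelfEnergyRe, h1, h2, h3, map_sub, selfEnergy_sub, Complex.sub_re, Fin.sum_univ_two]
    ring
  -- the read-out
  rw [klLocalPart, klLocalPart, ← eval_symInterp_sub, hdata]
  have hread := sum_evenWeight_abs_torusCosCoeff_locRe_map_gridSub_le (L := L) (M := M) hβ (fun p : GridPoint L N => p.2)
    (fun p => gridTime β N p.1) (Gg - G''g) (w := fun _ => (1 : ℝ)) (fun _ => zero_le_one) (fun _ => rfl) (B := B) (fun σ p₀ => by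
      rw [show (fun p₁ : GridPoint L N => (1 : ℝ) * ‖kernel ℂ (Gg - G''g) 2 (fun i => ((![p₀, p₁] i, σ), i))‖) =
          fun p₁ => ‖kernel ℂ (Gg - G''g) 2 (fun i => ((![p₀, p₁] i, σ), i))‖ from funext fun _ => one_mul _]
      refine (sum_norm_kernel_two_string_le_pinned (Gg - G''g) σ p₀).trans ?_
      refine le_trans (le_of_eq (sum_congr rfl fun X _ => ?_)) (hB σ ((p₀, σ), 0))
      rw [sub_eq_add_neg, kernel_add, ← neg_one_smul ℂ G''g, kernel_smul, neg_one_mul, ← sub_eq_add_neg, norm_sub_rev])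
  simp only [one_mul] at hread
  have hcard : (Fintype.card (GridPoint L N) : ℝ) = (N : ℝ) * (L : ℝ) ^ 2 := by
    rw [Fintype.card_prod, Fintype.card_fin, Fintype.card_pi, Fin.prod_const, ZMod.card]
    push_cast
    ring
  have hL : (0 : ℝ) < L := by exact_mod_cast Nat.pos_of_ne_zero (NeZero.ne L)
  have hconst : 2 * (Fintype.card (GridPoint L N) : ℝ) / (|β| * (L : ℝ) ^ 2) = 2 * (N : ℝ) / |β| := by
    rw [hcard]
    field_simp
  refine (abs_symInterp_eval_le _ _).trans ?_
  rw [← hconst]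
  simpa only [hubbardGridSub] using hread

/-- **THE TWO-CUTOFF DIFFERENCE OF THE SCALE-0 LOCAL PART, one sub-dyadic step** (`1 ≤ M ≤ M″ ≤ 2M`, shell floor `klE0 ≤ π(2M+1)/β`; the sizes
`α″, α_S, κ², ρ_S, ρ_C`, the profile `D` and the two smallness conditions as in `sum_norm_kernel_twoCutoff_effAction_sub_le`):
`|klLocalPart L M … 0 θ − klLocalPart L M″ … 0 θ| ≤ (2·4M″/|β|)·ρ_C^{-2}·e‖D‖_h/(1−θ_C)²` at every angle `θ`. -/
theorem abs_klLocalPart_zero_twoCutoff_sub_le [NeZero M] [NeZero M''] {β : ℝ} (hβ : 0 < β) (hM : 1 ≤ M) (h : M ≤ M'') (hM2 : M'' ≤ 2 * M)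
    (U μ : ℝ) (K : TrigPolyC4v) (hfloor : klE0 ≤ Real.pi * (2 * M + 1) / β)
    {κ : ℝ}
    (hIR : 1 / (β * (L : ℝ) ^ 2) * ∑ k : FreqMomentum L M'',
        (1 - hubbardCutoffWeightCT L M'' β μ K klE0 k) / Real.sqrt (matsubaraFreq β M'' k.1 ^ 2 + nambuXiCT L μ K k.2 ^ 2) ≤ κ ^ 2)
    {aC aS : ℝ} (haC : 0 < aC) (haS : 0 < aS)
    (hrowC : ∀ X, ∑ Y, ‖((hubbardGridSub L M'' β (2 * (2 * M''))).transpose * hubbardCovAboveCT L M'' β μ 0 K klE0 *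
      hubbardGridSub L M'' β (2 * (2 * M''))) X Y‖ ≤ aC)
    (hcolC : ∀ Y, ∑ X, ‖((hubbardGridSub L M'' β (2 * (2 * M''))).transpose * hubbardCovAboveCT L M'' β μ 0 K klE0 *
      hubbardGridSub L M'' β (2 * (2 * M''))) X Y‖ ≤ aC)
    (hrowS : ∀ X, ∑ Y, ‖((hubbardGridSub L M'' β (2 * (2 * M''))).transpose * hubbardCovShellCT L h β μ 0 K klE0 *
      hubbardGridSub L M'' β (2 * (2 * M''))) X Y‖ ≤ aS)
    (hcolS : ∀ Y, ∑ X, ‖((hubbardGridSub L M'' β (2 * (2 * M''))).transpose * hubbardCovShellCT L h β μ 0 K klE0 *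
      hubbardGridSub L M'' β (2 * (2 * M''))) X Y‖ ≤ aS)
    {ρS ρC : ℝ} (hρS : 0 < ρS) (hρC : 0 < ρC)
    (hθS : Real.exp 1 * aS * normV (GridLeg (GridPoint L (2 * (2 * M'')))) 1 ρS
        (fun m' => shellVertexProfile (2 * (2 * M'')) β U K (2 * m')) / 1 ^ 2 < 1)
    (D : ℕ → ℝ) (hD0 : ∀ m, 0 ≤ D m)
    (hD : ∀ m, 0 < m →
      (if m = 2 then 6 * ((4 + |μ| + K.coeffNorm 0) * β / (2 * Real.pi ^ 2 * M)) * (|U| * |β| / (2 * (2 * M'') : ℕ)) else 0) +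
        ρS⁻¹ ^ m * (Real.exp 1 * normV (GridLeg (GridPoint L (2 * (2 * M'')))) 1 ρS
            (fun m' => shellVertexProfile (2 * (2 * M'')) β U K (2 * m'))) *
          (Real.exp 1 * aS * normV (GridLeg (GridPoint L (2 * (2 * M'')))) 1 ρS
              (fun m' => shellVertexProfile (2 * (2 * M'')) β U K (2 * m')) / 1 ^ 2) /
          (1 - Real.exp 1 * aS * normV (GridLeg (GridPoint L (2 * (2 * M'')))) 1 ρS
              (fun m' => shellVertexProfile (2 * (2 * M'')) β U K (2 * m')) / 1 ^ 2) ≤ D m)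
    (hθC : Real.exp 1 * (aC + aS) *
        (normV (GridLeg (GridPoint L (2 * (2 * M'')))) (Real.sqrt (2 * (8 + κ ^ 2))) ρC
            (fun m' => shellVertexProfile (2 * (2 * M'')) β U K (2 * m')) +
          normV (GridLeg (GridPoint L (2 * (2 * M'')))) (Real.sqrt (2 * (8 + κ ^ 2))) ρC (fun m' => D (2 * m'))) /
        Real.sqrt (2 * (8 + κ ^ 2)) ^ 2 < 1)
    (θ : ℝ) :
    |klLocalPart L M β U μ K 0 θ - klLocalPart L M'' β U μ K 0 θ| ≤
      2 * ((2 * (2 * M'') : ℕ) : ℝ) / |β| *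
        (ρC⁻¹ ^ 2 * (Real.exp 1 * normV (GridLeg (GridPoint L (2 * (2 * M'')))) (Real.sqrt (2 * (8 + κ ^ 2))) ρC (fun m' => D (2 * m'))) /
          (1 - Real.exp 1 * (aC + aS) *
            (normV (GridLeg (GridPoint L (2 * (2 * M'')))) (Real.sqrt (2 * (8 + κ ^ 2))) ρC
                (fun m' => shellVertexProfile (2 * (2 * M'')) β U K (2 * m')) +
              normV (GridLeg (GridPoint L (2 * (2 * M'')))) (Real.sqrt (2 * (8 + κ ^ 2))) ρC (fun m' => D (2 * m'))) /
            Real.sqrt (2 * (8 + κ ^ 2)) ^ 2) ^ 2) := by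
  haveI : NeZero (2 * (2 * M'')) := ⟨by have := NeZero.ne M''; omega⟩
  have hΛ : (0 : ℝ) < klE0 := by norm_num [klE0]
  refine abs_klLocalPart_zero_twoCutoff_sub_le_of_grid hβ.ne' U μ K _ _
    (klEffectiveAction_zero_eq_map_gridSub hβ.ne' U μ K (by omega) (by omega)) (fun k σ => klSelfEnergy_zero_twoCutoff_eq h hβ.ne' U μ K k σ)
    (fun σ w => ?_) θ
  exact sum_norm_kernel_twoCutoff_effAction_sub_le hβ hM h hM2 U μ K hΛ hfloor hIR haC haS hrowC hcolC hrowS hcolS hρS hρC hθS D hD0 hD hθC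
    two_pos 0 w

end Summit.HubbardSuperconductivity.HubbardSuperconductivity.Theorems.TwoVolumeDefect

end
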